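import Summits.Parity.GeneralizedHardyLittlewood.Theorems.FordMaynardSieveConst01651SieveConst01651Witness
import HarnessLib

/-!
# Route `FordMaynardSieveConst01651`, target `SieveConst01651` (stmt-Parity-19185), stub `stub_coneCertClosed`:
# the grid API of the witness `coneCert` (edges strictly increasing; `cellIdx` locates points in cells)

Def-free helper file over `…CertTable` / `…Witness`.  Conjunct (i) (`IsPiecewiseConstOnCone coneCert`) and the
`k = 4, 5` type check both rest on three facts about the grid `e₀ < e₁ < ⋯ < e₈₅` (`certEdge`) and the locator
`cellIdx`:

* `certEdge_lt_succ`, `certEdge_strictMonoOn` — the `86` edges are strictly increasing (`decide +kernel` on the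
  rational table, then chaining);
* `certEdge_cellIdx_le`, `lt_certEdge_cellIdx_succ`, `cellIdx_le_of_lt_half` — for `ν₀ < t < 1/2`:
  `e_{cellIdx t} ≤ t < e_{cellIdx t + 1}` and `cellIdx t ≤ 83` (floor arithmetic on the two uniform sub-grids);
* `cellIdx_eq_of_mem_cell` — conversely `e_a < t < e_{a+1}`, `a ≤ 83` ⇒ `cellIdx t = a`; and for `t ∈ openSmall`
  the lower inequality is strict (`certEdge_cellIdx_lt`).

References: [FordMaynard2024PrimeSieves] arXiv:2407.14368, §8.2 (the certificate is a refinement of (8.2 b)).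
-/

noncomputable section

open Finset
open scoped Classical
open Literature.NumberTheory.Sieve Literature.NumberTheory.Sieve.FordMaynard

namespace Summit.Parity.GeneralizedHardyLittlewood.FordMaynardSieveConst01651SieveConst01651

/-! ### The edges are strictly increasing -/

/-- `e_a < e_{a+1}` for `a ≤ 84` (rational table check). [folklore] -/
theorem certEdge_lt_succ : ∀ a, a ≤ 84 → certEdge a < certEdge (a + 1) := by
  decide +kernel

/-- `e_a < e_b` for `a < b ≤ 85`. [folklore] -/
theorem certEdge_strictMonoOn {a b : ℕ} (hab : a < b) (hb : b ≤ 85) : certEdge a < certEdge b := by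
  induction b with
  | zero => omega
  | succ b ih =>
      rcases Nat.lt_succ_iff_lt_or_eq.1 hab with h | h
      · exact (ih h (by omega)).trans (certEdge_lt_succ b (by omega))
      · rw [h]; exact certEdge_lt_succ b (by omega)

/-- Real-cast form: `(e_a : ℝ) < e_b` for `a < b ≤ 85`. [folklore] -/
theorem certEdge_cast_lt {a b : ℕ} (hab : a < b) (hb : b ≤ 85) :
    ((certEdge a : ℚ) : ℝ) < ((certEdge b : ℚ) : ℝ) := by
  exact_mod_cast certEdge_strictMonoOn hab hb

/-! ### Closed forms of the edges on the two sub-grids -/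

/-- `e_a = ν₀ + a·w₁` for `a ≤ 72`. [folklore] -/
theorem certEdge_cast_of_le {a : ℕ} (ha : a ≤ 72) :
    ((certEdge a : ℚ) : ℝ) = 1651 / 10000 + (a : ℝ) * (283 / 120000) := by
  unfold certEdge; rw [if_pos ha]; push_cast; ring

/-- `e_a = 1/2 − ν₀ + (a − 72)·w₂` for `72 ≤ a ≤ 84` (at `a = 72` both formulas agree). [folklore] -/
theorem certEdge_cast_of_ge {a : ℕ} (ha : 72 ≤ a) (ha' : a ≤ 84) :
    ((certEdge a : ℚ) : ℝ) = 1 / 2 - 1651 / 10000 + ((a : ℝ) - 72) * (1651 / 120000) := by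
  unfold certEdge
  by_cases h72 : a ≤ 72
  · have : a = 72 := le_antisymm h72 ha
    subst this; rw [if_pos le_rfl]; push_cast; norm_num
  · rw [if_neg h72, if_pos ha']
    have : ((a - 72 : ℕ) : ℝ) = (a : ℝ) - 72 := by
      rw [Nat.cast_sub ha]; norm_num
    push_cast
    rw [this]

/-! ### `cellIdx` locates points of `(ν₀, 1/2)` -/

/-- For `ν₀ < t < 1/2`: `cellIdx t ≤ 83`, `e_{cellIdx t} ≤ t < e_{cellIdx t + 1}`. [folklore] -/
theorem cellIdx_spec {t : ℝ} (ht : (1651 / 10000 : ℝ) < t) (ht' : t < 1 / 2) :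
    cellIdx t ≤ 83 ∧ ((certEdge (cellIdx t) : ℚ) : ℝ) ≤ t ∧ t < ((certEdge (cellIdx t + 1) : ℚ) : ℝ) := by
  unfold cellIdx
  by_cases h1 : t < 1 / 2 - 1651 / 10000
  · rw [if_pos h1]
    set u : ℝ := (t - 1651 / 10000) / (283 / 120000) with hu
    have hu0 : 0 ≤ u := by rw [hu]; apply div_nonneg <;> linarith
    have hu72 : u < 72 := by rw [hu, div_lt_iff₀ (by norm_num)]; linarith
    have hfl : (⌊u⌋₊ : ℝ) ≤ u := Nat.floor_le hu0
    have hfl' : u < (⌊u⌋₊ : ℝ) + 1 := Nat.lt_floor_add_one u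
    have hn : ⌊u⌋₊ < 72 := (Nat.floor_lt hu0).2 (by exact_mod_cast hu72)
    refine ⟨by omega, ?_, ?_⟩
    · rw [certEdge_cast_of_le (by omega)]
      have : (⌊u⌋₊ : ℝ) * (283 / 120000) ≤ t - 1651 / 10000 := by
        have := mul_le_mul_of_nonneg_right hfl (by norm_num : (0 : ℝ) ≤ 283 / 120000)
        rw [hu, div_mul_cancel₀ _ (by norm_num)] at this; exact this
      linarith
    · rw [certEdge_cast_of_le (by omega)]
      have : t - 1651 / 10000 < ((⌊u⌋₊ : ℝ) + 1) * (283 / 120000) := by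
        have := mul_lt_mul_of_pos_right hfl' (by norm_num : (0 : ℝ) < 283 / 120000)
        rw [hu, div_mul_cancel₀ _ (by norm_num)] at this; exact this
      push_cast; linarith
  · rw [if_neg h1, if_pos ht']
    push Not at h1
    set u : ℝ := (t - (1 / 2 - 1651 / 10000)) / (1651 / 120000) with hu
    have hu0 : 0 ≤ u := by rw [hu]; apply div_nonneg <;> linarith
    have hu12 : u < 12 := by rw [hu, div_lt_iff₀ (by norm_num)]; linarith
    have hfl : (⌊u⌋₊ : ℝ) ≤ u := Nat.floor_le hu0
    have hfl' : u < (⌊u⌋₊ : ℝ) + 1 := Nat.lt_floor_add_one u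
    have hn : ⌊u⌋₊ < 12 := (Nat.floor_lt hu0).2 (by exact_mod_cast hu12)
    refine ⟨by omega, ?_, ?_⟩
    · rw [certEdge_cast_of_ge (by omega) (by omega)]
      have : (⌊u⌋₊ : ℝ) * (1651 / 120000) ≤ t - (1 / 2 - 1651 / 10000) := by
        have := mul_le_mul_of_nonneg_right hfl (by norm_num : (0 : ℝ) ≤ 1651 / 120000)
        rw [hu, div_mul_cancel₀ _ (by norm_num)] at this; exact this
      push_cast; linarith
    · rw [certEdge_cast_of_ge (by omega) (by omega)]
      have : t - (1 / 2 - 1651 / 10000) < ((⌊u⌋₊ : ℝ) + 1) * (1651 / 120000) := by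
        have := mul_lt_mul_of_pos_right hfl' (by norm_num : (0 : ℝ) < 1651 / 120000)
        rw [hu, div_mul_cancel₀ _ (by norm_num)] at this; exact this
      push_cast; linarith

/-- For `t` in an open small cell the lower edge inequality is strict: `e_{cellIdx t} < t`. [folklore] -/
theorem certEdge_cellIdx_lt {t : ℝ} (ht : t ∈ openSmall) : ((certEdge (cellIdx t) : ℚ) : ℝ) < t := by
  obtain ⟨h1, h2, h3⟩ := ht
  have hs := cellIdx_spec h1 h2
  rcases hs.2.1.lt_or_eq with h | h
  · exact h
  · exact absurd ⟨cellIdx t, by omega, h.symm⟩ h3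

/-- Conversely, `e_a < t < e_{a+1}` with `a ≤ 83` forces `cellIdx t = a`. [folklore] -/
theorem cellIdx_eq_of_mem_cell {t : ℝ} {a : ℕ} (ha : a ≤ 83) (h1 : ((certEdge a : ℚ) : ℝ) < t)
    (h2 : t < ((certEdge (a + 1) : ℚ) : ℝ)) : cellIdx t = a := by
  have hν : (1651 / 10000 : ℝ) < t := by
    have h0 : ((certEdge 0 : ℚ) : ℝ) ≤ ((certEdge a : ℚ) : ℝ) := by
      rcases Nat.eq_zero_or_pos a with h | h
      · rw [h]
      · exact (certEdge_cast_lt h (by omega)).le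
    have : ((certEdge 0 : ℚ) : ℝ) = 1651 / 10000 := by rw [certEdge_cast_of_le (by norm_num)]; norm_num
    linarith
  have hhalf : t < 1 / 2 := by
    have h84 : ((certEdge (a + 1) : ℚ) : ℝ) ≤ ((certEdge 84 : ℚ) : ℝ) := by
      rcases (show a + 1 ≤ 84 by omega).lt_or_eq with h | h
      · exact (certEdge_cast_lt h (by norm_num)).le
      · rw [h]
    have : ((certEdge 84 : ℚ) : ℝ) = 1 / 2 := by rw [certEdge_cast_of_ge (by norm_num) le_rfl]; norm_num
    linarith
  obtain ⟨hc83, hle, hlt⟩ := cellIdx_spec hν hhalf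
  -- the half-open cells `[e_c, e_{c+1})` are disjoint: compare indices through strict monotonicity
  by_contra hne
  rcases Nat.lt_or_gt_of_ne hne with h | h
  · -- cellIdx t < a: then e_{cellIdx t + 1} ≤ e_a < t, contradiction
    have : ((certEdge (cellIdx t + 1) : ℚ) : ℝ) ≤ ((certEdge a : ℚ) : ℝ) := by
      rcases (show cellIdx t + 1 ≤ a by omega).lt_or_eq with h' | h'
      · exact (certEdge_cast_lt h' (by omega)).le
      · rw [h']
    linarith
  · -- a < cellIdx t: then e_{a+1} ≤ e_{cellIdx t} ≤ t, contradiction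
    have : ((certEdge (a + 1) : ℚ) : ℝ) ≤ ((certEdge (cellIdx t) : ℚ) : ℝ) := by
      rcases (show a + 1 ≤ cellIdx t by omega).lt_or_eq with h' | h'
      · exact (certEdge_cast_lt h' (by omega)).le
      · rw [h']
    linarith

/-- An open cell `(e_a, e_{a+1})`, `a ≤ 83`, lies inside `openSmall` (it contains no edge). [folklore] -/
theorem mem_openSmall_of_mem_cell {t : ℝ} {a : ℕ} (ha : a ≤ 83) (h1 : ((certEdge a : ℚ) : ℝ) < t)
    (h2 : t < ((certEdge (a + 1) : ℚ) : ℝ)) : t ∈ openSmall := by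
  have h0 : ((certEdge 0 : ℚ) : ℝ) = 1651 / 10000 := by rw [certEdge_cast_of_le (by norm_num)]; norm_num
  have h84 : ((certEdge 84 : ℚ) : ℝ) = 1 / 2 := by rw [certEdge_cast_of_ge (by norm_num) le_rfl]; norm_num
  refine ⟨?_, ?_, ?_⟩
  · have : ((certEdge 0 : ℚ) : ℝ) ≤ ((certEdge a : ℚ) : ℝ) := by
      rcases Nat.eq_zero_or_pos a with h | h
      · rw [h]
      · exact (certEdge_cast_lt h (by omega)).le
    linarith
  · have : ((certEdge (a + 1) : ℚ) : ℝ) ≤ ((certEdge 84 : ℚ) : ℝ) := by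
      rcases (show a + 1 ≤ 84 by omega).lt_or_eq with h | h
      · exact (certEdge_cast_lt h (by norm_num)).le
      · rw [h]
    linarith
  · rintro ⟨b, hb, rfl⟩
    -- an edge strictly between `e_a` and `e_{a+1}` is impossible
    rcases Nat.lt_or_ge b (a + 1) with h | h
    · rcases Nat.lt_or_ge a b with h' | h'
      · omega
      · rcases h'.lt_or_eq with h'' | h''
        · exact absurd (certEdge_cast_lt h'' (by omega)) (not_lt.2 h1.le)
        · rw [h''] at h1; exact lt_irrefl _ h1
    · rcases h.lt_or_eq with h'' | h''
      · exact absurd (certEdge_cast_lt h'' hb) (not_lt.2 h2.le)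
      · rw [← h''] at h2; exact lt_irrefl _ h2

end Summit.Parity.GeneralizedHardyLittlewood.FordMaynardSieveConst01651SieveConst01651

end
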